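import Mathlib
import Literature.Probability.LatticeModels.ThermodynamicLimit
import Literature.Probability.LatticeModels.SharpnessProofs
import Summits.CriticalPhenomena.Ising3DConformalLimit.Theorems.PrecisionLaplacianDirectCorrelationStableTailExponentWindow
import Summits.CriticalPhenomena.Ising3DConformalLimit.Theorems.PrecisionLaplacianDirectCorrelationStableTailKernelScalingAux
import HarnessLib

/-!
# Helpers (II) for stub `stub_kernelScaling` of line `diffusive-branch-is-nonsaturation`
(crux `PrecisionLaplacian.DirectCorrelationStableTail`, item stmt-CriticalPhenomena-4799)

The lattice kernel at scale.  Let `G : ℤ³ → [0, 1]` satisfy the isotropic pure power law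
`G(x)|x|₂^{3-α} → c > 0` cofinitely, `1 < α < 2`, and write `g_R(v) = R^{3-α} G(⌊R v⌋)` for the
rescaled step kernel on `ℝ³ = Fin 3 → ℝ`.  This file provides

* the bounds `G(x) ≤ C₀|x|₂^{α-3}` (`x ≠ 0`) and `|G(x)|x|₂^{3-α} − c| ≤ η` outside a large ball;
* the pointwise comparison of `g_R` with the Riesz kernel `c|v|₂^{α-3}`: a crude bound valid
  everywhere (`kernSc_stepKernel_le`) and the far-region estimate
  `|g_R(v) − c|v|₂^{α-3}| ≤ η δ^{α-3} + 4cδ^{α-4}/R` for `|v|₂ > 2δ` (`kernSc_stepKernel_far`, mean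
  value theorem for `r ↦ r^{α-3}` on `[δ, ∞)`);
* fattening of a Gaussian envelope across a cell, and the representation of the rescaled lattice sum
  `R^{-α} Σₓ G(x) h(x/R + s)` as the integral of the step function `g_R(v) h(⌊Rv⌋/R + s)` with
  summability (registered helper sub-goal `stub_kernelScaling_auxSumAsIntegral`).

All statements are folklore; no definitions are introduced.
-/

noncomputable section

namespace Summit.CriticalPhenomena.Ising3DConformalLimit.Cruxes.DirectCorrelationStableTail.DiffusiveBranchIsNonsaturation

open MeasureTheory Filter Topology
open scoped BigOperators
open Literature.Probability.LatticeModels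
open Summit.CriticalPhenomena.Ising3DConformalLimit.Cruxes.DirectCorrelationStableTail.SelfEnergyPickInversion

/-! ### Bounds on the lattice kernel from the pure power law -/

/-- Upper bound `G(x) ≤ C₀ |x|₂^{α-3}` for all `x ≠ 0` from `G ≤ 1` and the cofinite power law.
[folklore] -/
theorem kernSc_kernel_upper {G : Site 3 → ℝ} {α c : ℝ} (hα : α < 3) (hc : 0 < c)
    (hG1 : ∀ x, G x ≤ 1)
    (hT : Tendsto (fun x : Site 3 => G x * √(∑ i, ((x i : ℝ)) ^ 2) ^ (3 - α)) cofinite (𝓝 c)) :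
    ∃ C₀ : ℝ, 0 < C₀ ∧ ∀ x : Site 3, x ≠ 0 → G x ≤ C₀ * √(∑ i, ((x i : ℝ)) ^ 2) ^ (α - 3) := by
  obtain ⟨c₁, C₁, R₀, -, -, hup, -⟩ :=
    expWin_scaleBounds_of_tendsto (κ := 3 - α) (by linarith) hc hG1 hT
  have h3 : 0 < √3 := Real.sqrt_pos.2 (by norm_num)
  refine ⟨max C₁ 1 * √3 ^ (3 - α), by positivity, fun x hx => ?_⟩
  have hx0 : 0 < ‖x‖ := norm_pos_iff.2 hx
  have hNpos : 0 < √(∑ i, ((x i : ℝ)) ^ 2) := one_pos.trans_le (one_le_sqrt_sum_sq x hx)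
  have hN : √(∑ i, ((x i : ℝ)) ^ 2) / √3 ≤ ‖x‖ := by
    rw [div_le_iff₀ h3, mul_comm]
    exact expWin_euclid_le_sqrt_three_mul_norm x
  calc G x ≤ C₁ * ‖x‖ ^ (-(3 - α)) := hup x hx
    _ ≤ max C₁ 1 * ‖x‖ ^ (-(3 - α)) :=
        mul_le_mul_of_nonneg_right (le_max_left _ _) (Real.rpow_nonneg hx0.le _)
    _ ≤ max C₁ 1 * (√(∑ i, ((x i : ℝ)) ^ 2) / √3) ^ (-(3 - α)) :=
        mul_le_mul_of_nonneg_left (Real.rpow_le_rpow_of_nonpos (by positivity) hN (by linarith))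
          (by positivity)
    _ = max C₁ 1 * √3 ^ (3 - α) * √(∑ i, ((x i : ℝ)) ^ 2) ^ (α - 3) := by
        rw [neg_sub, Real.div_rpow hNpos.le h3.le, div_eq_mul_inv, ← Real.rpow_neg h3.le, neg_sub]
        ring

/-- Quantitative form of the power law: `|G(x)|x|₂^{3-α} − c| ≤ η` outside a sup-norm ball.
[folklore] -/
theorem kernSc_kernel_asymp {G : Site 3 → ℝ} {α c : ℝ}
    (hT : Tendsto (fun x : Site 3 => G x * √(∑ i, ((x i : ℝ)) ^ 2) ^ (3 - α)) cofinite (𝓝 c))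
    {η : ℝ} (hη : 0 < η) :
    ∃ N : ℕ, 1 ≤ N ∧ ∀ x : Site 3, (N : ℝ) ≤ ‖x‖ →
      |G x * √(∑ i, ((x i : ℝ)) ^ 2) ^ (3 - α) - c| ≤ η := by
  have hev : ∀ᶠ x : Site 3 in cofinite,
      dist (G x * √(∑ i, ((x i : ℝ)) ^ 2) ^ (3 - α)) c < η := Metric.tendsto_nhds.1 hT η hη
  obtain ⟨N, hN1, hN⟩ := expWin_radius_of_eventually hev
  refine ⟨N, hN1, fun x hx => ?_⟩
  have h := hN x hx
  rw [Real.dist_eq] at h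
  exact h.le

/-- Mean value bound for a non-positive real power on `[δ, ∞)`:
`|p^β − q^β| ≤ |β| δ^{β-1} |p − q|`. [folklore] -/
theorem kernSc_rpow_sub_rpow_le {β δ p q : ℝ} (hβ : β ≤ 0) (hδ : 0 < δ) (hp : δ ≤ p) (hq : δ ≤ q) :
    |p ^ β - q ^ β| ≤ |β| * δ ^ (β - 1) * |p - q| := by
  have hderiv : ∀ x ∈ Set.Ici δ,
      HasDerivWithinAt (fun x : ℝ => x ^ β) (β * x ^ (β - 1)) (Set.Ici δ) x :=
    fun x hx => (Real.hasDerivAt_rpow_const (Or.inl (hδ.trans_le hx).ne')).hasDerivWithinAt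
  have hbound : ∀ x ∈ Set.Ici δ, ‖β * x ^ (β - 1)‖ ≤ |β| * δ ^ (β - 1) := fun x hx => by
    rw [Real.norm_eq_abs, abs_mul, abs_of_nonneg (Real.rpow_nonneg (hδ.trans_le hx).le _)]
    exact mul_le_mul_of_nonneg_left (Real.rpow_le_rpow_of_nonpos hδ hx (by linarith))
      (abs_nonneg _)
  have h := (convex_Ici δ).norm_image_sub_le_of_norm_hasDerivWithin_le hderiv hbound hq hp
  simpa only [Real.norm_eq_abs] using h

/-! ### Fattening a Gaussian envelope across a cell -/

/-- If `v` and `w` are `ρ`-close coordinatewise then `|v + s|₂² ≤ 2|w + s|₂² + 6ρ²`. [folklore] -/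
theorem kernSc_sum_sq_shift_le (v w s : Fin 3 → ℝ) {ρ : ℝ} (h : ∀ i, |v i - w i| ≤ ρ) :
    ∑ i, (v i + s i) ^ 2 ≤ 2 * ∑ i, (w i + s i) ^ 2 + 6 * ρ ^ 2 := by
  have hi : ∀ i, (v i + s i) ^ 2 ≤ 2 * (w i + s i) ^ 2 + 2 * ρ ^ 2 := fun i => by
    have h1 : (v i - w i) ^ 2 ≤ ρ ^ 2 := by
      rw [← sq_abs]
      exact pow_le_pow_left₀ (abs_nonneg _) (h i) 2
    nlinarith [sq_nonneg (v i + s i - 2 * (w i + s i))]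
  calc ∑ i, (v i + s i) ^ 2 ≤ ∑ i, (2 * (w i + s i) ^ 2 + 2 * ρ ^ 2) :=
        Finset.sum_le_sum fun i _ => hi i
    _ = 2 * ∑ i, (w i + s i) ^ 2 + 6 * ρ ^ 2 := by
        rw [Finset.sum_add_distrib, Finset.mul_sum]
        simp
        ring

/-- A Gaussian envelope evaluated at the rounded point `⌊Rv⌋/R` (`R ≥ 1`) is dominated by a wider
Gaussian at `v`: `e^{-a|⌊Rv⌋/R + s|₂²} ≤ e^{3a} e^{-(a/2)|v + s|₂²}`. [folklore] -/
theorem kernSc_exp_floor_le {a : ℝ} (ha : 0 ≤ a) {R : ℝ} (hR : 1 ≤ R) (v s : Fin 3 → ℝ) :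
    Real.exp (-(a * ∑ i, ((⌊R * v i⌋ : ℝ) / R + s i) ^ 2)) ≤
      Real.exp (3 * a) * Real.exp (-(a / 2 * ∑ i, (v i + s i) ^ 2)) := by
  have hRpos : 0 < R := one_pos.trans_le hR
  rw [← Real.exp_add]
  apply Real.exp_le_exp.2
  have hclose : ∀ i, |v i - (⌊R * v i⌋ : ℝ) / R| ≤ 1 := fun i => by
    obtain ⟨h0, h1⟩ := kernSc_sub_floor_div_mem hRpos (v i)
    rw [abs_of_nonneg h0]
    exact h1.trans (by rw [div_le_one hRpos]; exact hR)
  have h := kernSc_sum_sq_shift_le v (fun i => (⌊R * v i⌋ : ℝ) / R) s hclose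
  have h2 := mul_le_mul_of_nonneg_left h (by positivity : (0 : ℝ) ≤ a / 2)
  nlinarith [h2]

/-! ### Pointwise comparison of the step kernel with the Riesz kernel -/

/-- Crude bound valid everywhere: `R^{3-α} G(⌊Rv⌋) ≤ R^{3-α} 𝟙{⌊Rv⌋ = 0} + 9 C₀ ‖v‖^{α-3}`, from
`G ≤ 1`, `G(x) ≤ C₀|x|₂^{α-3}` (`x ≠ 0`) and `|⌊Rv⌋/R|₂ ≥ |v|₂/3`. [folklore] -/
theorem kernSc_stepKernel_le {G : Site 3 → ℝ} {α C₀ : ℝ} (hG1 : ∀ x, G x ≤ 1)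
    (hα1 : 1 < α) (hα3 : α - 3 < 0) (hC₀ : 0 < C₀)
    (hup : ∀ x : Site 3, x ≠ 0 → G x ≤ C₀ * √(∑ i, ((x i : ℝ)) ^ 2) ^ (α - 3))
    {R : ℝ} (hRpos : 0 < R) (v : Fin 3 → ℝ) :
    R ^ (3 - α) * G (fun i => ⌊R * v i⌋) ≤
      ((fun v : Fin 3 → ℝ => (fun i => ⌊R * v i⌋ : Site 3)) ⁻¹' {0}).indicator
          (fun _ => R ^ (3 - α)) v + 9 * C₀ * ‖v‖ ^ (α - 3) := by
  set x : Site 3 := fun i => ⌊R * v i⌋ with hx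
  set w : Fin 3 → ℝ := fun i => (x i : ℝ) / R with hw
  have hind : 0 ≤ ((fun v : Fin 3 → ℝ => (fun i => ⌊R * v i⌋ : Site 3)) ⁻¹' {0}).indicator
      (fun _ => R ^ (3 - α)) v :=
    Set.indicator_nonneg (fun _ _ => Real.rpow_nonneg hRpos.le _) v
  by_cases hx0 : x = 0
  · have hv0 : v ∈ (fun v : Fin 3 → ℝ => (fun i => ⌊R * v i⌋ : Site 3)) ⁻¹' {0} := hx0
    rw [Set.indicator_of_mem hv0]
    have h1 : R ^ (3 - α) * G x ≤ R ^ (3 - α) * 1 :=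
      mul_le_mul_of_nonneg_left (hG1 x) (Real.rpow_nonneg hRpos.le _)
    have h2 : 0 ≤ 9 * C₀ * ‖v‖ ^ (α - 3) := by positivity
    change R ^ (3 - α) * G x ≤ _
    linarith
  · have hvw : √(∑ i, (v i - w i) ^ 2) ≤ 2 / R := kernSc_euclid_sub_floor_le hRpos v
    have hNvw : |√(∑ i, v i ^ 2) - √(∑ i, w i ^ 2)| ≤ 2 / R :=
      (kernSc_abs_euclid_sub_euclid_le v w).trans hvw
    have hNw : √(∑ i, w i ^ 2) = √(∑ i, ((x i : ℝ)) ^ 2) / R := sqrt_sum_sq_intCast_div x hRpos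
    have hNx1 : 1 ≤ √(∑ i, ((x i : ℝ)) ^ 2) := one_le_sqrt_sum_sq x hx0
    have hNxpos : 0 < √(∑ i, ((x i : ℝ)) ^ 2) := one_pos.trans_le hNx1
    have hNwpos : 0 < √(∑ i, w i ^ 2) := by rw [hNw]; positivity
    have hNwR : 1 / R ≤ √(∑ i, w i ^ 2) := by
      rw [hNw]
      exact div_le_div_of_nonneg_right hNx1 hRpos.le
    have hv0 : v ≠ 0 := by
      intro h
      apply hx0
      funext i
      simp [hx, h]
    have hNvpos : 0 < √(∑ i, v i ^ 2) :=
      (norm_pos_iff.2 hv0).trans_le (norm_le_sqrt_sum_sq v)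
    have hNv3 : √(∑ i, v i ^ 2) ≤ 3 * √(∑ i, w i ^ 2) := by
      have h1 := (abs_sub_le_iff.1 hNvw).1
      have h2 : (2 : ℝ) / R = 2 * (1 / R) := by ring
      linarith
    have hscale : R ^ (3 - α) * √(∑ i, ((x i : ℝ)) ^ 2) ^ (α - 3) = √(∑ i, w i ^ 2) ^ (α - 3) := by
      rw [hNw, Real.div_rpow hNxpos.le hRpos.le, show (3 - α) = -(α - 3) by ring,
        Real.rpow_neg hRpos.le, div_eq_mul_inv, mul_comm]
    have hg1 : R ^ (3 - α) * G x ≤ C₀ * √(∑ i, w i ^ 2) ^ (α - 3) :=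
      calc R ^ (3 - α) * G x ≤ R ^ (3 - α) * (C₀ * √(∑ i, ((x i : ℝ)) ^ 2) ^ (α - 3)) :=
            mul_le_mul_of_nonneg_left (hup x hx0) (Real.rpow_nonneg hRpos.le _)
        _ = C₀ * (R ^ (3 - α) * √(∑ i, ((x i : ℝ)) ^ 2) ^ (α - 3)) := by ring
        _ = C₀ * √(∑ i, w i ^ 2) ^ (α - 3) := by rw [hscale]
    have hw3 : √(∑ i, w i ^ 2) ^ (α - 3) ≤ 9 * √(∑ i, v i ^ 2) ^ (α - 3) := by
      have h1 : √(∑ i, v i ^ 2) / 3 ≤ √(∑ i, w i ^ 2) := by linarith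
      have h2 : √(∑ i, w i ^ 2) ^ (α - 3) ≤ (√(∑ i, v i ^ 2) / 3) ^ (α - 3) :=
        Real.rpow_le_rpow_of_nonpos (by positivity) h1 hα3.le
      have h3 : (√(∑ i, v i ^ 2) / 3) ^ (α - 3) = √(∑ i, v i ^ 2) ^ (α - 3) * 3 ^ (3 - α) := by
        rw [Real.div_rpow hNvpos.le (by norm_num), show (3 - α) = -(α - 3) by ring,
          Real.rpow_neg (by norm_num), div_eq_mul_inv]
      have h4 : (3 : ℝ) ^ (3 - α) ≤ (3 : ℝ) ^ (2 : ℝ) :=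
        Real.rpow_le_rpow_of_exponent_le (by norm_num) (by linarith)
      rw [Real.rpow_two] at h4
      calc √(∑ i, w i ^ 2) ^ (α - 3) ≤ √(∑ i, v i ^ 2) ^ (α - 3) * 3 ^ (3 - α) := h2.trans h3.le
        _ ≤ √(∑ i, v i ^ 2) ^ (α - 3) * 9 :=
            mul_le_mul_of_nonneg_left (h4.trans (by norm_num)) (Real.rpow_nonneg hNvpos.le _)
        _ = 9 * √(∑ i, v i ^ 2) ^ (α - 3) := by ring
    have hv3 : √(∑ i, v i ^ 2) ^ (α - 3) ≤ ‖v‖ ^ (α - 3) := kernSc_euclid_rpow_le_norm_rpow hα3 v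
    change R ^ (3 - α) * G x ≤ _
    calc R ^ (3 - α) * G x ≤ C₀ * √(∑ i, w i ^ 2) ^ (α - 3) := hg1
      _ ≤ C₀ * (9 * ‖v‖ ^ (α - 3)) :=
          mul_le_mul_of_nonneg_left (hw3.trans (by nlinarith [hC₀])) hC₀.le
      _ = 0 + 9 * C₀ * ‖v‖ ^ (α - 3) := by ring
      _ ≤ _ := by linarith [hind]

/-- Far-region comparison: if `|v|₂ > 2δ`, `2/R ≤ δ`, and the power law holds with accuracy `η`
outside the sup-norm ball of radius `N ≤ Rδ/2`, then
`|R^{3-α}G(⌊Rv⌋) − c|v|₂^{α-3}| ≤ η δ^{α-3} + 4cδ^{α-4}/R`. [folklore] -/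
theorem kernSc_stepKernel_far {G : Site 3 → ℝ} {α c η δ : ℝ} {N : ℕ}
    (hα1 : 1 < α) (hα2 : α < 2) (hc : 0 < c) (hδ0 : 0 < δ) (hη0 : 0 < η)
    (hN : ∀ x : Site 3, (N : ℝ) ≤ ‖x‖ → |G x * √(∑ i, ((x i : ℝ)) ^ 2) ^ (3 - α) - c| ≤ η)
    {R : ℝ} (hRpos : 0 < R) (hRδ : 2 / R ≤ δ) (hRN : (N : ℝ) ≤ R * δ / 2) (v : Fin 3 → ℝ)
    (hfar : 2 * δ < √(∑ i, v i ^ 2)) :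
    |R ^ (3 - α) * G (fun i => ⌊R * v i⌋) - c * √(∑ i, v i ^ 2) ^ (α - 3)| ≤
      η * δ ^ (α - 3) + 4 * c * δ ^ (α - 4) / R := by
  have hα3 : α - 3 < 0 := by linarith
  set x : Site 3 := fun i => ⌊R * v i⌋ with hx
  set w : Fin 3 → ℝ := fun i => (x i : ℝ) / R with hw
  have hvw : √(∑ i, (v i - w i) ^ 2) ≤ 2 / R := kernSc_euclid_sub_floor_le hRpos v
  have hNvw : |√(∑ i, v i ^ 2) - √(∑ i, w i ^ 2)| ≤ 2 / R :=
    (kernSc_abs_euclid_sub_euclid_le v w).trans hvw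
  have hNw : √(∑ i, w i ^ 2) = √(∑ i, ((x i : ℝ)) ^ 2) / R := sqrt_sum_sq_intCast_div x hRpos
  have hNwge : δ ≤ √(∑ i, w i ^ 2) := by
    have h1 := (abs_sub_le_iff.1 hNvw).1
    linarith
  have hNvge : δ ≤ √(∑ i, v i ^ 2) := by linarith
  have hNwpos : 0 < √(∑ i, w i ^ 2) := hδ0.trans_le hNwge
  have hx0 : x ≠ 0 := by
    intro h0
    have h1 : √(∑ i, w i ^ 2) = 0 := by
      rw [hNw]
      simp [h0]
    linarith
  have hNxpos : 0 < √(∑ i, ((x i : ℝ)) ^ 2) := one_pos.trans_le (one_le_sqrt_sum_sq x hx0)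
  have hNx : √(∑ i, ((x i : ℝ)) ^ 2) = R * √(∑ i, w i ^ 2) := by
    rw [hNw, mul_div_cancel₀ _ hRpos.ne']
  have hxnorm : (N : ℝ) ≤ ‖x‖ := by
    have h1 : √(∑ i, ((x i : ℝ)) ^ 2) ≤ √3 * ‖x‖ := expWin_euclid_le_sqrt_three_mul_norm x
    have h3 : √3 ≤ 2 := by
      rw [show (2 : ℝ) = √4 by
        rw [show (4 : ℝ) = 2 ^ 2 by norm_num, Real.sqrt_sq zero_le_two]]
      exact Real.sqrt_le_sqrt (by norm_num)
    have h2 : √3 * ‖x‖ ≤ 2 * ‖x‖ := mul_le_mul_of_nonneg_right h3 (norm_nonneg _)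
    have h4 : R * δ ≤ R * √(∑ i, w i ^ 2) := mul_le_mul_of_nonneg_left hNwge hRpos.le
    linarith
  have hq : |G x * √(∑ i, ((x i : ℝ)) ^ 2) ^ (3 - α) - c| ≤ η := hN x hxnorm
  have hR3 : R ^ (3 - α) = (R ^ (α - 3))⁻¹ := by
    rw [show (3 - α) = -(α - 3) by ring, Real.rpow_neg hRpos.le]
  have hone : √(∑ i, ((x i : ℝ)) ^ 2) ^ (3 - α) * √(∑ i, ((x i : ℝ)) ^ 2) ^ (α - 3) = 1 := by
    rw [← Real.rpow_add hNxpos]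
    simp
  have hgq : R ^ (3 - α) * G x =
      G x * √(∑ i, ((x i : ℝ)) ^ 2) ^ (3 - α) * √(∑ i, w i ^ 2) ^ (α - 3) := by
    rw [hNw, Real.div_rpow hNxpos.le hRpos.le,
      show G x * √(∑ i, ((x i : ℝ)) ^ 2) ^ (3 - α) *
          (√(∑ i, ((x i : ℝ)) ^ 2) ^ (α - 3) / R ^ (α - 3)) =
        G x * (√(∑ i, ((x i : ℝ)) ^ 2) ^ (3 - α) * √(∑ i, ((x i : ℝ)) ^ 2) ^ (α - 3)) *
          (R ^ (α - 3))⁻¹ by ring, hone, hR3]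
    ring
  have hsplit : R ^ (3 - α) * G x - c * √(∑ i, v i ^ 2) ^ (α - 3) =
      (G x * √(∑ i, ((x i : ℝ)) ^ 2) ^ (3 - α) - c) * √(∑ i, w i ^ 2) ^ (α - 3) +
        c * (√(∑ i, w i ^ 2) ^ (α - 3) - √(∑ i, v i ^ 2) ^ (α - 3)) := by
    rw [hgq]
    ring
  have hT1 : |(G x * √(∑ i, ((x i : ℝ)) ^ 2) ^ (3 - α) - c) * √(∑ i, w i ^ 2) ^ (α - 3)| ≤
      η * δ ^ (α - 3) := by
    rw [abs_mul, abs_of_nonneg (Real.rpow_nonneg hNwpos.le _)]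
    exact mul_le_mul hq (Real.rpow_le_rpow_of_nonpos hδ0 hNwge hα3.le)
      (Real.rpow_nonneg hNwpos.le _) hη0.le
  have hT2 : |c * (√(∑ i, w i ^ 2) ^ (α - 3) - √(∑ i, v i ^ 2) ^ (α - 3))| ≤
      4 * c * δ ^ (α - 4) / R := by
    rw [abs_mul, abs_of_pos hc]
    have hmvt := kernSc_rpow_sub_rpow_le (β := α - 3) hα3.le hδ0 hNwge hNvge
    have hβ : |α - 3| ≤ 2 := by
      rw [abs_le]
      constructor <;> linarith
    have hd : |√(∑ i, w i ^ 2) - √(∑ i, v i ^ 2)| ≤ 2 / R := by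
      rw [abs_sub_comm]
      exact hNvw
    have hδp : 0 ≤ δ ^ (α - 3 - 1) := Real.rpow_nonneg hδ0.le _
    calc c * |√(∑ i, w i ^ 2) ^ (α - 3) - √(∑ i, v i ^ 2) ^ (α - 3)|
        ≤ c * (|α - 3| * δ ^ (α - 3 - 1) * |√(∑ i, w i ^ 2) - √(∑ i, v i ^ 2)|) :=
          mul_le_mul_of_nonneg_left hmvt hc.le
      _ ≤ c * (2 * δ ^ (α - 3 - 1) * (2 / R)) := by
          apply mul_le_mul_of_nonneg_left _ hc.le
          exact mul_le_mul (mul_le_mul_of_nonneg_right hβ hδp) hd (abs_nonneg _) (by positivity)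
      _ = 4 * c * δ ^ (α - 4) / R := by
          rw [show α - 3 - 1 = α - 4 by ring]
          ring
  change |R ^ (3 - α) * G x - c * √(∑ i, v i ^ 2) ^ (α - 3)| ≤ _
  rw [hsplit]
  exact (abs_add_le _ _).trans (add_le_add hT1 hT2)

/-! ### Lattice sums as integrals of step functions -/

/-- The rescaled lattice sum `R^{-α} Σₓ G(x) h(x/R + s)` as the integral of the step function
`R^{3-α} G(⌊Rv⌋) h(⌊Rv⌋/R + s)`, with summability, for `0 ≤ G ≤ 1` and `h` continuous with a
Gaussian envelope. [folklore] -/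
theorem kernSc_sum_as_integral {G : Site 3 → ℝ} (hG0 : ∀ x, 0 ≤ G x) (hG1 : ∀ x, G x ≤ 1)
    (α : ℝ) {a A : ℝ} (ha : 0 < a) (hA : 0 ≤ A) {R : ℕ} (hR : 1 ≤ R) {h : (Fin 3 → ℝ) → ℝ}
    (hcont : Continuous h) (henv : ∀ w, |h w| ≤ A * Real.exp (-(a * ∑ i, w i ^ 2)))
    (s : Fin 3 → ℝ) :
    Summable (fun x : Site 3 => G x * h (fun i => (x i : ℝ) / R + s i)) ∧
    Integrable (fun v : Fin 3 → ℝ => (R : ℝ) ^ (3 - α) * (G (fun i => ⌊(R : ℝ) * v i⌋) *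
        h (fun i => ((⌊(R : ℝ) * v i⌋ : ℤ) : ℝ) / R + s i))) ∧
    (R : ℝ) ^ (-α) * ∑' x : Site 3, G x * h (fun i => (x i : ℝ) / R + s i) =
      ∫ v : Fin 3 → ℝ, (R : ℝ) ^ (3 - α) * (G (fun i => ⌊(R : ℝ) * v i⌋) *
        h (fun i => ((⌊(R : ℝ) * v i⌋ : ℤ) : ℝ) / R + s i)) := by
  have hR1 : (1 : ℝ) ≤ R := by exact_mod_cast hR
  have hRpos : (0 : ℝ) < R := one_pos.trans_le hR1
  set F : Site 3 → ℝ := fun x => G x * h (fun i => (x i : ℝ) / R + s i) with hF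
  have hmeasF : AEStronglyMeasurable (fun v : Fin 3 → ℝ => F (fun i => ⌊(R : ℝ) * v i⌋)) := by
    have h1 : Measurable (fun v : Fin 3 → ℝ => G (fun i => ⌊(R : ℝ) * v i⌋)) :=
      (measurable_of_countable G).comp (kernSc_measurable_floorMap _)
    have h2 : Measurable (fun v : Fin 3 → ℝ => (fun i => ((⌊(R : ℝ) * v i⌋ : ℤ) : ℝ) / R + s i)) := by
      refine measurable_pi_lambda _ fun i => ?_
      exact (measurable_of_countable (fun z : ℤ => (z : ℝ) / R + s i)).comp
        (Int.measurable_floor.comp (by fun_prop : Measurable fun v : Fin 3 → ℝ => (R : ℝ) * v i))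
    exact (h1.mul (hcont.measurable.comp h2)).aestronglyMeasurable
  have hdom : ∀ v : Fin 3 → ℝ, ‖F (fun i => ⌊(R : ℝ) * v i⌋)‖ ≤
      A * Real.exp (3 * a) * Real.exp (-(a / 2 * ∑ i, (v i + s i) ^ 2)) := by
    intro v
    rw [Real.norm_eq_abs, hF]
    simp only
    rw [abs_mul, abs_of_nonneg (hG0 _)]
    calc G (fun i => ⌊(R : ℝ) * v i⌋) * |h (fun i => ((⌊(R : ℝ) * v i⌋ : ℤ) : ℝ) / R + s i)|
        ≤ 1 * (A * Real.exp (-(a * ∑ i, (((⌊(R : ℝ) * v i⌋ : ℤ) : ℝ) / R + s i) ^ 2))) :=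
          mul_le_mul (hG1 _) (henv _) (abs_nonneg _) zero_le_one
      _ ≤ A * (Real.exp (3 * a) * Real.exp (-(a / 2 * ∑ i, (v i + s i) ^ 2))) := by
          rw [one_mul]
          exact mul_le_mul_of_nonneg_left (kernSc_exp_floor_le ha.le hR1 v s) hA
      _ = A * Real.exp (3 * a) * Real.exp (-(a / 2 * ∑ i, (v i + s i) ^ 2)) := by ring
  have hintF : Integrable (fun v : Fin 3 → ℝ => F (fun i => ⌊(R : ℝ) * v i⌋)) :=
    Integrable.mono' ((kernSc_integrable_gauss (half_pos ha) s).const_mul (A * Real.exp (3 * a)))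
      hmeasF (ae_of_all _ hdom)
  obtain ⟨hsum, hval⟩ := kernSc_integral_floor hRpos F hintF
  refine ⟨hsum, hintF.const_mul ((R : ℝ) ^ (3 - α)), ?_⟩
  rw [integral_const_mul, hval, ← mul_assoc]
  congr 1
  rw [Real.rpow_sub hRpos, Real.rpow_neg hRpos.le,
    show (R : ℝ) ^ (3 : ℝ) = (R : ℝ) ^ (3 : ℕ) by exact_mod_cast Real.rpow_natCast (R : ℝ) 3]
  field_simp

/-- **Registered helper sub-goal `stub_kernelScaling_auxSumAsIntegral`** of stub `stub_kernelScaling`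
(line `diffusive-branch-is-nonsaturation`, crux stmt-CriticalPhenomena-4799): for `0 ≤ G ≤ 1` and a
continuous `h` with Gaussian envelope, `x ↦ G(x) h(x/R + s)` is summable over `ℤ³` and
`R^{-α} Σₓ G(x) h(x/R + s) = ∫ R^{3-α} G(⌊Rv⌋) h(⌊Rv⌋/R + s) dv` (`R ≥ 1`). [folklore] -/
theorem stub_kernelScaling_auxSumAsIntegral :
    ∀ (G : Site 3 → ℝ) (α a A : ℝ) (R : ℕ) (h : (Fin 3 → ℝ) → ℝ) (s : Fin 3 → ℝ),
      (∀ x, 0 ≤ G x) → (∀ x, G x ≤ 1) → 0 < a → 0 ≤ A → 1 ≤ R → Continuous h →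
      (∀ w, |h w| ≤ A * Real.exp (-(a * ∑ i, w i ^ 2))) →
      Summable (fun x : Site 3 => G x * h (fun i => (x i : ℝ) / R + s i)) ∧
      MeasureTheory.Integrable (fun v : Fin 3 → ℝ => (R : ℝ) ^ (3 - α) *
        (G (fun i => ⌊(R : ℝ) * v i⌋) * h (fun i => ((⌊(R : ℝ) * v i⌋ : ℤ) : ℝ) / R + s i))) ∧
      (R : ℝ) ^ (-α) * ∑' x : Site 3, G x * h (fun i => (x i : ℝ) / R + s i) =
        ∫ v : Fin 3 → ℝ, (R : ℝ) ^ (3 - α) *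
          (G (fun i => ⌊(R : ℝ) * v i⌋) * h (fun i => ((⌊(R : ℝ) * v i⌋ : ℤ) : ℝ) / R + s i)) :=
  fun _G α _a _A _R _h s hG0 hG1 ha hA hR hcont henv =>
    kernSc_sum_as_integral hG0 hG1 α ha hA hR hcont henv s

end Summit.CriticalPhenomena.Ising3DConformalLimit.Cruxes.DirectCorrelationStableTail.DiffusiveBranchIsNonsaturation

end
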